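import Summits.BirchSwinnertonDyer.BirchSwinnertonDyer.Theorems.AdditiveBranchIMCGenusKolyvaginCarrierLabelsGuarded
import Summits.BirchSwinnertonDyer.BirchSwinnertonDyer.Theorems.ErratumRoadFiveEulerHalfGenusKolyvaginSubmoduleTransfer
import Summits.BirchSwinnertonDyer.Rank1Residual.X11b.KolyvaginH37Bridge
import HarnessLib

/-!
# The `E′`-labelled ring-class-rational Kolyvagin datum (S4♯ currency) on a Galois-STABLE SUBMODULE — the
# two-module engine

Cell `bsd-stepL` (ER5 Euler-half), ideator seat `bsd-idea-9` (g24), line of record `genus` on the sub-item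
`EulerHalfPOnlyMultPotMultTwinAtFive` (stmt-BirchSwinnertonDyer-23444; registered stub `stub_genusEprimeKolyvaginDatumRC :
GenusEprimeKolyvaginDatumSupply`, skeleton `Cruxes/…/Lines/genus.lean` v1.5). Landed `--supports stmt-BirchSwinnertonDyer-23444
--as helper`. Summit-side THEOREM-ONLY file (no definition, no instance, no notation, no named fact, no `sorry`).

## What
`hpointsEprime_of_shimuraLabels_kolyvaginGuarded` is the guarded engine `hpointsRk_of_shimuraLabels_kolyvaginGuarded`
(`…AdditiveBranchIMCGenusKolyvaginCarrierLabelsGuarded`, depth `k := 0`) RUN ON TWO MODULES AT ONCE: the big module `E(K[m])`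
(where McCallum's switch (4.4) and the point divisibility live) and a Galois-stable additive SUBMODULE `B(m) ≤ E(K[m])` containing
the bare family `y(m)` and the pushed-forward `y(m/ℓ)` (where the `E′`-side Néron label lives). Same data and labels (B2)–(B5)
as the engine; new labels `hBgal`/`hBy`/`hBincl` (stability of `B`, membership), `hBE0` (Néron label: `n'·(j b)_v ∈ E⁰`-receptacle
at `v ∣ p` for `b ∈ B(m)`), `hDiv` (divisibility of the derived point `P_m = Σ_s s·D_m y(m)` by `p^{min(M,t)}` in `E(K[m])`, in
the instance-free `KolyvaginOperator.derivedPoint` currency); conclusion = the body of the genus line's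
`GenusKolyvaginEprimePointsR W p K ι y_K t n'` (conductor spelled `N`) with `A(m) := j(B(lev m))`.
Proof = the engine's proof text with `k` dropped (big-module telescope `h37t`/`h44t`/`hcmp` VERBATIM), then the def-free
submodule transfer of `…GenusKolyvaginSubmoduleTransfer` (P4) moves admissibility (Gross Lemma 4.3), `P_m ∈ invPoints`
(McCallum (4)), the reflection law (Gross 5.4 (1)) and the classes to `j(B(m))`; `KolyvaginH37Bridge.map_kolyvaginPoint_eq_derivedPoint`
identifies the abstract `kolyvaginPoint` with the instance-free derived point for `hDiv`.

HONEST FRAMING: theorems only; every label is a hypothesis; nothing is discharged on any crux by this file alone (the `E′`-side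
Néron label and the point divisibility `hDiv` — ord_p of the Tamagawa product, the research residual of S4♯ — are what the genus
wrapper must supply from its own named hypotheses). No summit statement is proved; BSD is proved for no curve.
[cite: GrossLMS1991, §3 (3.3), Props. 3.6, 3.7, §4 (4.1), Lemma 4.3, Props. 5.3, 5.4 (1), 6.2 (1)]
[cite: McCallumLMS1991, §4 (4)–(6), Lemma 4.1, Lemma 4.3, Prop. 4.4, Cor. 4.5] [cite: BertoliniDarmon1996, §2.4–2.6]
[cite: GrossZagier1986, I (6.3), V (2.3)] [cite: Jetchev2008, Thm. 1.4]
presearch: "Kolyvagin derived classes on a Galois stable submodule / Tamagawa divisibility of Heegner points" → [corpus: Jetchev2008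
Thm 1.4] (divisibility by `max_v ord_p c_v`, not the sum); no tree theorem runs the guarded engine on a submodule
(`lean search 'hpointsRk_of_shimuraLabels'` → K4e, its guarded twin, their wrappers).
-/

noncomputable section

open scoped Classical

set_option linter.dupNamespace false

namespace Summit.BirchSwinnertonDyer.BirchSwinnertonDyer.Theorems.GenusSharpKolyvagin

open WeierstrassCurve Field NumberField IsDedekindDomain Finset
  Literature.NumberTheory.EllipticCurves Literature.NumberTheory.GaloisRepresentations
  Literature.NumberTheory.EllipticCurves.KolyvaginCocycle
  Literature.NumberTheory.EllipticCurves.KolyvaginEuler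
  Literature.NumberTheory.EllipticCurves.RingClassField
  Literature.NumberTheory.EllipticCurves.ModularForms
  Summit.BirchSwinnertonDyer.Rank1Residual.X11b
  Summit.BirchSwinnertonDyer.BirchSwinnertonDyer.Theorems

variable {K : Type} [Field K] [NumberField K] {W : WeierstrassCurve ℚ}

set_option maxHeartbeats 1600000 in
/-- **The guarded engine on two modules** (S4♯ currency of the genus line): from bare CM points
`y(m) ∈ E(K[m])`, `y_K ∈ E(K)`, `ε = ±1`, the labels (B2)–(B5) of `hpointsRk_of_shimuraLabels_kolyvaginGuarded`,
a Galois-stable submodule family `B(m) ∋ y(m), incl(y(m/ℓ))` (`hBgal`, `hBy`, `hBincl`), the Néron label `hBE0` on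
`B` and the point divisibility `hDiv` of the derived points by `p^{min(M,t)}`, the body of
`GenusKolyvaginEprimePointsR W p K ι y_K t n'` with `A(m) = j(B(m))`. [cite: GrossLMS1991, §§3–6]
[cite: McCallumLMS1991, §4 (4)–(6), Cor. 4.5] [cite: BertoliniDarmon1996, §2] [cite: Jetchev2008, Thm. 1.4] -/
theorem hpointsEprime_of_shimuraLabels_kolyvaginGuarded (hK : IsImaginaryQuadratic K) (ι : K →+* ℂ) {N : ℕ} [NeZero N] [W.IsElliptic] [W.IsGloballyMinimal] (hN : W.conductorNorm ℤ = N)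
    (Dt : ModularParametrizationData W N) {p : ℕ} (hp : p.Prime) (hp2 : p ≠ 2) (hρ : W.HasSurjectiveModNGaloisRep p)
    (y : (m : ℕ) → (W.baseChange (ringClassField K ι m)).toAffine.Point)
    {yK : (W.baseChange K).toAffine.Point} {ε : ℤ} (hε : ε = 1 ∨ ε = -1)
    (hB2 : ∀ T : Finset (ringClassField K ι 1 ≃ₐ[ℚ] ringClassField K ι 1), (∀ g, g ∈ T ↔ g ∈ ringClassGal ι 1) →
      WeierstrassCurve.Affine.Point.map (W' := W) (algebraMap K (ringClassField K ι 1)).toRatAlgHom yK = ∑ g ∈ T, pointGalHom W (ringClassField K ι 1) g (y 1))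
    (hB3 : ∀ (m : ℕ), Squarefree m → (∀ q ∈ m.primeFactors, IsKolyvaginPrime N W K p q) → ∀ τm : ringClassField K ι m ≃ₐ[ℚ] ringClassField K ι m,
      (∀ x : ringClassField K ι m, ((τm x : ringClassField K ι m) : ℂ) = starRingEnd ℂ x) →
      ∃ σ' ∈ ringClassGal ι m, IsOfFinAddOrder (pointGalHom W (ringClassField K ι m) τm (y m) - ε • pointGalHom W (ringClassField K ι m) σ' (y m)))
    (hB3K : ∀ c : K ≃ₐ[ℚ] K, c ≠ 1 → IsOfFinAddOrder (WeierstrassCurve.Affine.Point.map (W' := W) (c : K →ₐ[ℚ] K) yK - ε • yK))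
    (hB4 : ∀ m : ℕ, Squarefree m → (∀ q ∈ m.primeFactors, IsKolyvaginPrime N W K p q) →
      ∀ (ℓ : ℕ) (_ : ℓ ∈ m.primeFactors) (hle : ringClassField K ι (m / ℓ) ≤ ringClassField K ι m)
        (σ : ringClassField K ι m ≃ₐ[ℚ] ringClassField K ι m), Subgroup.zpowers σ = ringClassGalOver ι m (m / ℓ) →
        letI : Algebra K ℂ := ι.toAlgebra
        ∑ i ∈ Finset.range (ℓ + 1), pointGalHom W (ringClassField K ι m) (σ ^ i) (y m) = W.frobeniusTrace ℓ • WeierstrassCurve.Affine.Point.map (W' := W)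
            ((RingClassField.inclusion ι hle).restrictScalars ℚ) (y (m / ℓ)))
    (hB5 : ∀ m : ℕ, Squarefree m → (∀ q ∈ m.primeFactors, IsKolyvaginPrime N W K p q) →
      ∀ (ℓ : ℕ) (_ : ℓ ∈ m.primeFactors) [Fact ℓ.Prime] (hΔ : ¬ (ℓ : ℤ) ∣ minimalDiscriminantInt W)
        (φ₀ : absoluteGaloisGroup (ZMod ℓ)), (∀ x : AlgebraicClosure (ZMod ℓ), φ₀ • x = x ^ ℓ) →
      ∀ (hle : ringClassField K ι (m / ℓ) ≤ ringClassField K ι m) (emb : ringClassField K ι m →+* AlgebraicClosure K),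
        (∀ x : K, emb (algebraMap K (ringClassField K ι m) x) = algebraMap K (AlgebraicClosure K) x) →
      ∀ (j : (W.baseChange (ringClassField K ι m)).toAffine.Point →+ geomPoints (W.baseChange K)), j = WeierstrassCurve.Affine.Point.map (W' := W) emb.toRatAlgHom →
      ∀ γ : ringClassField K ι m ≃ₐ[ℚ] ringClassField K ι m, γ ∈ ringClassGal ι m →
        letI : Algebra K ℂ := ι.toAlgebra
        geomReduction hΔ ((RatClosure.pointsEquiv (K := K) W).symm (j (pointGalHom W (ringClassField K ι m) γ (y m)))) =
          φ₀ • geomReduction hΔ ((RatClosure.pointsEquiv (K := K) W).symm (j (pointGalHom W (ringClassField K ι m) γ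
              (WeierstrassCurve.Affine.Point.map (W' := W) ((RingClassField.inclusion ι hle).restrictScalars ℚ) (y (m / ℓ)))))))
    (t : ℕ) (n' : ℤ) (B : ∀ k' : ℕ, AddSubgroup (W.baseChange (ringClassField K ι k')).toAffine.Point)
    (hBgal : ∀ (k' : ℕ) (τ' : ringClassField K ι k' ≃ₐ[ℚ] ringClassField K ι k') (a : (W.baseChange (ringClassField K ι k')).toAffine.Point),
      a ∈ B k' → pointGalHom W (ringClassField K ι k') τ' a ∈ B k')
    (hBy : ∀ k', y k' ∈ B k')
    (hBincl : ∀ (k' ℓ : ℕ), ℓ ∈ k'.primeFactors → ∀ hle : ringClassField K ι (k' / ℓ) ≤ ringClassField K ι k', letI : Algebra K ℂ := ι.toAlgebra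
      WeierstrassCurve.Affine.Point.map (W' := W) ((RingClassField.inclusion ι hle).restrictScalars ℚ) (y (k' / ℓ)) ∈ B k')
    (hBE0 : ∀ (k' : ℕ) (emb : ringClassField K ι k' →+* AlgebraicClosure K), (∀ x : K, emb (algebraMap K (ringClassField K ι k') x) = algebraMap K (AlgebraicClosure K) x) →
      ∀ (j : (W.baseChange (ringClassField K ι k')).toAffine.Point →+ geomPoints (W.baseChange K)), j = WeierstrassCurve.Affine.Point.map (W' := W) emb.toRatAlgHom →
      ∀ b ∈ B k', ∀ v : HeightOneSpectrum (𝓞 K), ((p : ℕ) : 𝓞 K) ∈ v.asIdeal →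
        n' • pointsMap (W.baseChange K) (v.adicCompletion K) (j b) ∈ E0Receptacle (W.baseChange K) v)
    (hDiv : ∀ {M : ℕ}, 1 ≤ M → ∀ m : ℕ, Squarefree m → (∀ q ∈ m.primeFactors, IsKolyvaginPrime N W K p q ∧ FrobEqFrobInfty W K (p ^ M) q) →
      ∀ (g : ℕ → (ringClassField K ι m ≃ₐ[ℚ] ringClassField K ι m)) (S : Finset (ringClassField K ι m ≃ₐ[ℚ] ringClassField K ι m)),
        (∀ ℓ ∈ m.primeFactors, Subgroup.zpowers (g ℓ) = ringClassGalOver ι m (m / ℓ)) →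
        (∀ s ∈ S, s ∈ ringClassGal ι m) → (∀ h ∈ ringClassGal ι m, ∃! s, s ∈ S ∧ h⁻¹ * s ∈ ringClassGalOver ι m 1) →
        ∃ z : (W.baseChange (ringClassField K ι m)).toAffine.Point, ((p ^ min M t : ℕ) : ℤ) • z = KolyvaginOperator.derivedPoint (pointGalHom W (ringClassField K ι m)) g m S (y m)) :
    ∀ {M : ℕ} (_hM : 1 ≤ M) (hdiv : ∀ Q : geomPoints (W.baseChange K), ∃ R, ((p ^ M : ℕ) : ℤ) • R = Q)
      (c : K ≃ₐ[ℚ] K) (_hc : c ≠ 1),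
      ∃ (ε : ℤ) (τ : AlgebraicClosure K ≃+* AlgebraicClosure K) (hτ : IsLiftOfAut c τ)
        (A : ℕ → AddSubgroup (geomPoints (W.baseChange K))) (hA : ∀ m, KolyvaginCocycle.IsAdmissible (Field.absoluteGaloisGroup K) (A m) ((p ^ M : ℕ) : ℤ))
        (emb : ∀ m : ℕ, ringClassField K ι m →ₐ[K] AlgebraicClosure K) (Pn : ℕ → geomPoints (W.baseChange K))
        (hPn : ∀ m, Pn m ∈ KolyvaginCocycle.invPoints (Field.absoluteGaloisGroup K) (A m) ((p ^ M : ℕ) : ℤ)),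
        (ε = 1 ∨ ε = -1) ∧
        IsOfFinAddOrder (Affine.Point.map (W' := W) (c : K →ₐ[ℚ] K) yK - ε • yK) ∧
        (∀ m, ∀ a ∈ A m, hτ.pointsMap W a ∈ A m) ∧
        Pn 1 = toGeomPoints (W.baseChange K) yK ∧
        (∀ m, m ≠ 0 → ∀ a ∈ A m, ∀ Φ : Field.absoluteGaloisGroup K,
          (∀ x : ringClassField K ι m, Φ • emb m x = emb m x) → Φ • a = a) ∧
        (∀ m, ∀ a ∈ A m, ∀ v : HeightOneSpectrum (𝓞 K), ((p : ℕ) : 𝓞 K) ∈ v.asIdeal →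
          n' • pointsMap (W.baseChange K) (v.adicCompletion K) a ∈ E0Receptacle (W.baseChange K) v) ∧
        (∀ m : ℕ, Squarefree m →
          (∀ q ∈ m.primeFactors, IsKolyvaginPrime N W K p q ∧ FrobEqFrobInfty W K (p ^ M) q) →
          (∃ b ∈ A m, hτ.pointsMap W (Pn m) = (ε * (-1) ^ m.primeFactors.card) • Pn m + ((p ^ M : ℕ) : ℤ) • b) ∧
          (∀ ℓ : ℕ, ℓ.Prime → ℓ ∣ m → ∀ v : HeightOneSpectrum (𝓞 K), (ℓ : 𝓞 K) ∈ v.asIdeal →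
            ∀ a : ℕ, (((p : ℤ) ^ a) • kolyvaginClass (W.baseChange K) _ hdiv (hA m) (Pn m) (hPn m) ∈
                selmerLocalKer (W.baseChange K) (v.adicCompletion K) ((p ^ M : ℕ) : ℤ) ↔
              ((p : ℤ) ^ a) • kolyvaginClass (W.baseChange K) _ hdiv (hA (m / ℓ)) (Pn (m / ℓ)) (hPn (m / ℓ)) ∈
                (W.baseChange K).torsionLocalKer (v.adicCompletion K) ((p ^ M : ℕ) : ℤ))) ∧
          ((p : ℤ) ^ (M - t)) • kolyvaginClass (W.baseChange K) _ hdiv (hA m) (Pn m) (hPn m) = 0) := by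
  intro M hM hdiv c hc
  let Kol : ℕ → Prop := fun m ↦ Squarefree m ∧ ∀ q ∈ m.primeFactors, IsKolyvaginPrime N W K p q ∧ FrobEqFrobInfty W K (p ^ M) q
  let lev : ℕ → ℕ := fun m ↦ if Kol m then m else 1
  have hKol1 : Kol 1 := ⟨squarefree_one, by simp⟩
  have hlev : ∀ m, Kol (lev m) := fun m ↦ by by_cases h : Kol m <;> simp only [lev, if_pos, if_neg, h, hKol1, not_false_eq_true]
  have hlev_eq : ∀ m, Kol m → lev m = m := fun m h ↦ if_pos h
  have hlev0 : ∀ m, lev m ≠ 0 := fun m ↦ Squarefree.ne_zero (hlev m).1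
  have hlevdvd : ∀ m, lev m ∣ m := fun m ↦ by
    by_cases h : Kol m; · rw [hlev_eq m h]
    rw [show lev m = 1 from if_neg h]; exact one_dvd m
  have hinert : ∀ m, ∀ q ∈ (lev m).primeFactors, (Ideal.span {(q : 𝓞 K)}).IsPrime := fun m q hq ↦ ((hlev m).2 q hq).1.2.2.2.2.1
  have hKdiv : ∀ (m k' : ℕ), k' ∣ lev m → Kol k' := fun m k' hk ↦ ⟨(hlev m).1.squarefree_of_dvd hk,
    fun q hq ↦ (hlev m).2 q (Nat.primeFactors_mono hk (hlev0 m) hq)⟩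
  have hKolM : ∀ (m k' : ℕ), k' ∣ lev m → ∀ q ∈ k'.primeFactors, IsKolyvaginPrime N W K p q ∧ FrobEqFrobInfty W K (p ^ M) q :=
    fun m k' hk ↦ (hKdiv m k' hk).2
  have hguard : ∀ (m k' : ℕ), k' ∣ lev m → ∀ q ∈ k'.primeFactors, IsKolyvaginPrime N W K p q := fun m k' hk q hq ↦ ((hKdiv m k' hk).2 q hq).1
  have hk'0 : ∀ (m k' : ℕ), k' ∣ lev m → k' ≠ 0 := fun m k' hk ↦ ne_zero_of_dvd_ne_zero (hlev0 m) hk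
  choose res gen Tr emb σ H f π j e h1 h4 h5 he1 hβ hord hj hπρ hfsec hHρ hdict hjunk using
    fun m : ℕ ↦ exists_ringClassLevelData hK ι (hlev m).1 (hinert m) W
  letI hcg : ∀ k', CommGroup (ringClassGal ι k') := fun k' ↦ { (inferInstance : Group (ringClassGal ι k')) with
    mul_comm := fun a b ↦ (KolyvaginH44.isMulCommutative_ringClassGal' hK ι k').is_comm.comm a b }
  haveI hfin : ∀ k', Finite (ringClassGal ι k') := KolyvaginH44.finite_ringClassGal hK ι
  letI act : ∀ k', DistribMulAction (ringClassGal ι k') ((W.baseChange (ringClassField K ι k')).toAffine.Point) := fun k' ↦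
    DistribMulAction.compHom _ ((pointGalHom W (ringClassField K ι k')).comp (ringClassGal ι k').subtype)
  letI hft : ∀ m k', Fintype (ringClassGal ι k' ⧸ H m k') := fun m k' ↦ Fintype.ofFinite _
  have hsmul : ∀ (k') (g : ringClassGal ι k') (Q : (W.baseChange (ringClassField K ι k')).toAffine.Point),
      g • Q = pointGalHom W (ringClassField K ι k') (g : ringClassField K ι k' ≃ₐ[ℚ] ringClassField K ι k') Q := fun _ _ _ ↦ rfl
  have hmul : ∀ (k') (a b : ringClassField K ι k' ≃ₐ[ℚ] ringClassField K ι k') (Q : (W.baseChange (ringClassField K ι k')).toAffine.Point),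
      pointGalHom W (ringClassField K ι k') (a * b) Q = pointGalHom W (ringClassField K ι k') a (pointGalHom W (ringClassField K ι k') b Q) := fun k' a b Q ↦ by rw [map_mul]; rfl
  set ρ : ∀ k', ringClassGal ι k' →* (ringClassField K ι k' ≃ₐ[ℚ] ringClassField K ι k') := fun k' ↦ (ringClassGal ι k').subtype with hρdef
  have hρi : ∀ k', Function.Injective (ρ k') := fun k' ↦ (ringClassGal ι k').subtype_injective
  have hj' : ∀ (m k') (γ : absoluteGaloisGroup K) (a : (W.baseChange (ringClassField K ι k')).toAffine.Point),
      j m k' (π m k' γ • a) = γ • j m k' a := fun m k' γ a ↦ by rw [hsmul]; exact hj m k' γ a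
  have hπρ' : ∀ (m k') (t : absoluteGaloisGroup K) (x : ringClassField K ι k'), t • e m k' x = e m k' (ρ k' (π m k' t) x) := fun m k' t x ↦ hπρ m k' t x
  have hjQ : ∀ (m k' : ℕ) (hk : k' ∣ lev m) (Q : (W.baseChange (ringClassField K ι k')).toAffine.Point),
      j m k' Q = WeierstrassCurve.Affine.Point.map (W' := W) (emb m k' hk).toRatAlgHom Q := fun m k' hk Q ↦ DFunLike.congr_fun (hdict m k' hk).1 Q
  have hσres : ∀ (m k' : ℕ) (hk : k' ∣ lev m), ∀ q ∈ k'.primeFactors,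
      (σ m k' q : ringClassField K ι k' ≃ₐ[ℚ] ringClassField K ι k') = res m k' (gen m q) := fun m k' hk ↦ (hdict m k' hk).2.1
  have hfS : ∀ (m k' : ℕ) (hk : k' ∣ lev m) (c' : ringClassGal ι k' ⧸ H m k'),
      (f m k' c' : ringClassField K ι k' ≃ₐ[ℚ] ringClassField K ι k') ∈ (Tr m).image (fun t ↦ res m k' t) := fun m k' hk ↦ (hdict m k' hk).2.2.1
  have hz : ∀ (m k' : ℕ) (hk : k' ∣ lev m), ∀ q ∈ k'.primeFactors, (Subgroup.zpowers (σ m k' q)).map (ρ k') = ringClassGalOver ι k' (k' / q) := by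
    intro m k' hk q hq; rw [MonoidHom.map_zpowers]
    change Subgroup.zpowers (σ m k' q : ringClassField K ι k' ≃ₐ[ℚ] ringClassField K ι k') = _
    rw [hσres m k' hk q hq]; exact (h4 m k' hk q hq).1
  have hzz : ∀ (m k' : ℕ) (hk : k' ∣ lev m), ∀ q ∈ k'.primeFactors, Subgroup.zpowers (res m k' (gen m q)) = ringClassGalOver ι k' (k' / q) := fun m k' hk q hq ↦ (h4 m k' hk q hq).1
  have hSsub : ∀ (m k' : ℕ) (_ : k' ∣ lev m), ∀ s ∈ (Tr m).image (fun t ↦ res m k' t), s ∈ ringClassGal ι k' := by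
    intro m k' hk s hs; obtain ⟨t, -, rfl⟩ := Finset.mem_image.mp hs
    exact RingClassTower.restrictHom_mem_ringClassGal ι (h1 m k' hk) t
  have hSρ : ∀ (m k' : ℕ) (hk : k' ∣ lev m),
      ((Tr m).image (fun t ↦ res m k' t) : Set (ringClassField K ι k' ≃ₐ[ℚ] ringClassField K ι k')) ⊆ Set.range (ρ k') := fun m k' hk s hs ↦ ⟨⟨s, hSsub m k' hk s hs⟩, rfl⟩
  have hX : ∀ (k' : ℕ), k' ≠ 0 → ∀ (n₀ : ℕ) (a : (W.baseChange (ringClassField K ι k')).toAffine.Point),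
      ((p ^ n₀ : ℕ) : ℤ) • a = 0 → a = 0 := fun k' hk n₀ a ha ↦
    RingClassNoTorsion.eq_zero_of_zsmul_pow_eq_zero_ringClassField W hK ι hk hp hp2 hρ n₀ a ha
  have hjinj : ∀ (m k' : ℕ) (_ : k' ∣ lev m), Function.Injective (j m k') := by
    intro m k' hk a b hab; rw [hjQ m k' hk, hjQ m k' hk] at hab
    exact WeierstrassCurve.Affine.Point.map_injective (W' := W) (emb m k' hk).toRatAlgHom hab
  have hAdiv : ∀ (m k' : ℕ) (_ : k' ∣ lev m) (n₀ : ℕ), IsAdmissible (absoluteGaloisGroup K) (j m k').range ((p ^ n₀ : ℕ) : ℤ) :=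
    fun m k' hk n₀ ↦ isAdmissible_range_of_galoisEquivariant (π m k') (j m k') (hj' m k') (hjinj m k' hk) (hX k' (hk'0 m k' hk) n₀)
  have hAzero : ∀ (m k' : ℕ), ¬ k' ∣ lev m → ∀ n₀ : ℤ, IsAdmissible (absoluteGaloisGroup K) (j m k').range n₀ := by
    intro m k' hk n₀; rw [hjunk m k' hk]
    exact ⟨fun g x hx ↦ by obtain ⟨a, rfl⟩ := hx; exact ⟨a, by rw [AddMonoidHom.zero_apply, smul_zero]⟩,
      fun x hx _ ↦ by obtain ⟨a, rfl⟩ := hx; rw [AddMonoidHom.zero_apply]⟩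
  have hAt : ∀ (m k' : ℕ), IsAdmissible (absoluteGaloisGroup K) (j m k').range ((p ^ M : ℕ) : ℤ) :=
    fun m k' ↦ if hk : k' ∣ lev m then hAdiv m k' hk M else hAzero m k' hk _
  have hgen : ∀ (m k' : ℕ) (_ : k' ∣ lev m), H m k' ≤ Subgroup.closure (σ m k' '' (k'.primeFactors : Set ℕ)) := fun m k' hk ↦
    le_closure_of_map_zpowers hK ι ((hlev m).1.squarefree_of_dvd hk) (σ m k') (H m k') (ρ k') (hρi k') (hz m k' hk) (fun h hh ↦ hHρ m k' h hh)
  have hdvdM : ∀ (m k' : ℕ) (_ : k' ∣ lev m), ∀ ℓ ∈ k'.primeFactors, ((p ^ M : ℕ) : ℤ) ∣ ((ℓ + 1 : ℕ) : ℤ) := fun m k' hk ℓ hℓ ↦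
    (IsKolyvaginPrime.pow_dvd_add_one W hp ((hKdiv m k' hk).2 ℓ hℓ).1 hM ((hKdiv m k' hk).2 ℓ hℓ).2).1
  have hB4e : ∀ (m k' : ℕ) (_ : k' ∣ lev m), ∀ ℓ ∈ k'.primeFactors, ∃ y' ∈ B k',
      grAct ((W.baseChange (ringClassField K ι k')).toAffine.Point) (traceElt (σ m k' ℓ) ℓ) (y k') = W.frobeniusTrace ℓ • y' ∧
        ((p ^ M : ℕ) : ℤ) ∣ W.frobeniusTrace ℓ := by
    intro m k' hk ℓ hℓ
    have hle : ringClassField K ι (k' / ℓ) ≤ ringClassField K ι k' :=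
      ringClassField_mono hK ι (Nat.div_dvd_of_dvd (Nat.dvd_of_mem_primeFactors hℓ)) (hk'0 m k' hk)
    letI : Algebra K ℂ := ι.toAlgebra
    refine ⟨_, hBincl k' ℓ hℓ hle, ?_, pow_dvd_frobeniusTrace_of_kolyvaginPrime (K := K) Dt hp hM ((hKdiv m k' hk).2 ℓ hℓ).1 ((hKdiv m k' hk).2 ℓ hℓ).2⟩
    rw [grAct_traceElt, ← hB4 k' (hKdiv m k' hk).1 (hguard m k' hk) ℓ hℓ hle (σ m k' ℓ : ringClassField K ι k' ≃ₐ[ℚ] ringClassField K ι k')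
      (by rw [hσres m k' hk ℓ hℓ]; exact hzz m k' hk ℓ hℓ)]
    exact Finset.sum_congr rfl fun i _ ↦ by rw [hsmul, Subgroup.coe_pow]
  have htrn : ∀ (m k' : ℕ) (_ : k' ∣ lev m), ∀ ℓ ∈ k'.primeFactors,
      grAct ((W.baseChange (ringClassField K ι k')).toAffine.Point) (traceElt (σ m k' ℓ) ℓ) (y k') ∈
        zsmulRange ((W.baseChange (ringClassField K ι k')).toAffine.Point) ((p ^ M : ℕ) : ℤ) := by
    intro m k' hk ℓ hℓ; obtain ⟨y', -, hrel, ha⟩ := hB4e m k' hk ℓ hℓ; exact grAct_traceElt_mem_of_eq_smul hrel ha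
  have hPtn : ∀ (m k' : ℕ) (_ : k' ∣ lev m), j m k' (kolyvaginPoint (σ m k') k'.primeFactors (f m k') (y k')) ∈
      invPoints (absoluteGaloisGroup K) (j m k').range ((p ^ M : ℕ) : ℤ) := fun m k' hk ↦
    map_kolyvaginPoint_mem_invPoints (hfsec m k') (hgen m k' hk) (hord m k') (hdvdM m k' hk) (htrn m k' hk) (π m k') (j m k') (hj' m k')
  have hPtt : ∀ (m k' : ℕ), j m k' (kolyvaginPoint (σ m k') k'.primeFactors (f m k') (y k')) ∈
      invPoints (absoluteGaloisGroup K) (j m k').range ((p ^ M : ℕ) : ℤ) := by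
    intro m k'; by_cases hk : k' ∣ lev m; · exact hPtn m k' hk
    rw [hjunk m k' hk, AddMonoidHom.zero_apply]; exact AddSubgroup.zero_mem _
  have hIt : ∀ (m k' : ℕ), ∀ v : HeightOneSpectrum (𝓞 K), (k' : 𝓞 K) ∉ v.asIdeal →
      ∀ 𝔐 ∈ v.localPrimesAbove, ∀ t ∈ 𝔐.inertia (absoluteGaloisGroup (v.adicCompletion K)),
        resGal (K := K) (v.adicCompletion K) t • j m k' (kolyvaginPoint (σ m k') k'.primeFactors (f m k') (y k')) =
          j m k' (kolyvaginPoint (σ m k') k'.primeFactors (f m k') (y k')) := by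
    intro m k' v hv 𝔐 h𝔐 t ht
    have hk0 : k' ≠ 0 := by rintro rfl; exact hv (by rw [Nat.cast_zero]; exact v.asIdeal.zero_mem)
    exact resGal_smul_map_eq_self_of_galoisDictionary hK ι hk0 (π m k') (j m k') (hj' m k') (e m k') (ρ k') (hρi k') (hπρ' m k') hv h𝔐 ht _
  have h37t : ∀ m : ℕ, ∀ k' : ℕ, k' ∣ lev m → Squarefree k' →
      (∀ q ∈ k'.primeFactors, IsKolyvaginPrime N W K p q ∧ FrobEqFrobInfty W K (p ^ M) q) →
      ∀ ℓ : ℕ, ℓ.Prime → ℓ ∣ k' →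
      ℓ ∈ k'.primeFactors ∧ ∃ y' : (W.baseChange (ringClassField K ι k')).toAffine.Point,
        j m k' (kolyvaginPoint (σ m k') ((k'.primeFactors).erase ℓ) (f m k') y') =
          j m (k' / ℓ) (kolyvaginPoint (σ m (k' / ℓ)) (k' / ℓ).primeFactors (f m (k' / ℓ)) (y (k' / ℓ))) ∧
        grAct _ (traceElt (σ m k' ℓ) ℓ) (y k') = W.frobeniusTrace ℓ • y' ∧
        ∀ [Fact ℓ.Prime] (hΔ : ¬ (ℓ : ℤ) ∣ minimalDiscriminantInt W)
          (φ₀ : absoluteGaloisGroup (ZMod ℓ)), (∀ x : AlgebraicClosure (ZMod ℓ), φ₀ • x = x ^ ℓ) →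
          ∀ γ : ringClassGal ι k',
            geomReduction hΔ ((RatClosure.pointsEquiv (K := K) W).symm (j m k' (γ • y k'))) =
              φ₀ • geomReduction hΔ ((RatClosure.pointsEquiv (K := K) W).symm (j m k' (γ • y'))) := by
    intro m
    refine h37_of_labels hK ι p M (n := lev m) (fun k' _ ↦ y k')
      (fun k' _ q ↦ res m k' (gen m q)) (fun k' _ ↦ (Tr m).image (fun t ↦ res m k' t))
      (fun k' hk ↦ hSsub m k' hk) (fun k' hk ↦ h5 m k' hk) (fun k' _ ↦ j m k') ?_ ?_ ?_
      (σ m) (fun k' ↦ k'.primeFactors) (H m) (f m) (fun k' ↦ y k') (j m) ρ hρi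
      (fun _ ↦ AddEquiv.refl _) (fun k' _ g a ↦ hsmul k' g a) (fun _ _ _ ↦ rfl) (fun _ _ ↦ rfl)
      (fun k' hk ↦ hσres m k' hk) (fun _ _ ↦ rfl) (fun k' _ ↦ hfsec m k') (fun k' hk ↦ hfS m k' hk)
      (fun k' _ ↦ hHρ m k') (fun k' _ g ↦ g.2) (fun k' hk ↦ hSρ m k' hk)
    · intro k' hk ℓ hℓ hle
      have hd : k' / ℓ ∣ k' := Nat.div_dvd_of_dvd (Nat.dvd_of_mem_primeFactors hℓ)
      obtain ⟨hi, hii⟩ := hβ m k' hk (k' / ℓ) hd hle (k' / ℓ) (y (k' / ℓ))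
      rw [hjQ m k' hk, hjQ m (k' / ℓ) (hd.trans hk), hi, hii]
    · intro k' hk ℓ hℓ hle
      exact hB4 k' (hKdiv m k' hk).1 (hguard m k' hk) ℓ hℓ hle (res m k' (gen m ℓ)) (hzz m k' hk ℓ hℓ)
    · intro k' hk ℓ hℓ _ hΔ φ₀ hφ₀ hle γ hγ
      exact hB5 k' (hKdiv m k' hk).1 (hguard m k' hk) ℓ hℓ hΔ φ₀ hφ₀ hle (emb m k' hk) (he1 m k' hk) (j m k') (hdict m k' hk).1 γ hγ
  have h44t := fun m : ℕ ↦ h44_of_prop37_on_of_conductorNorm hK ι hN hp hp2 hM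
    (W.exists_weilPairing_holds p) hdiv (σ m) (fun k' ↦ k'.primeFactors) (H m) (f m) (hord m)
    (fun k' ↦ y k') (π m) (j m) (hj' m) (hAt m) (hPtt m) (hIt m) (fun k' ↦ k' ∣ lev m) (h37t m) (e m) ρ hρi (hπρ' m) (fun k' hk ↦ hz m k' hk)
  have hcmp : ∀ (m₁ k₁ : ℕ) (hk₁ : k₁ ∣ lev m₁) (m₂ k₂ : ℕ) (hk₂ : k₂ ∣ lev m₂) (_ : k₂ = k₁)
      (H' : AddSubgroup (galH1Torsion (W.baseChange K) ((p ^ M : ℕ) : ℤ))) (t : ℤ),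
      t • kolyvaginClass (W.baseChange K) _ hdiv (hAt m₁ k₁)
          (j m₁ k₁ (kolyvaginPoint (σ m₁ k₁) k₁.primeFactors (f m₁ k₁) (y k₁))) (hPtt m₁ k₁) ∈ H' ↔
        t • kolyvaginClass (W.baseChange K) _ hdiv (hAt m₂ k₂)
          (j m₂ k₂ (kolyvaginPoint (σ m₂ k₂) k₂.primeFactors (f m₂ k₂) (y k₂))) (hPtt m₂ k₂) ∈ H' := by
    intro m₁ k₁ hk₁ m₂ k₂ hk₂ hkk H' t; subst hkk
    exact zsmul_kolyvaginClass_mem_iff_of_presentations_of_pow_eq_one hK ι Dt hp hM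
      ((hlev m₂).1.squarefree_of_dvd hk₂) (hKolM m₂ k₂ hk₂) hdiv hdiv (ρ k₂) (hρi k₂) (fun g ↦ g.2)
      (fun g a ↦ hsmul k₂ g a) (y k₂) (fun ℓ hℓ σ₀ hσ₀ ↦ ⟨_, hB4 k₂ (hKdiv m₂ k₂ hk₂).1 (hguard m₂ k₂ hk₂) ℓ hℓ
        (ringClassField_mono hK ι (Nat.div_dvd_of_dvd (Nat.dvd_of_mem_primeFactors hℓ)) (hk'0 m₂ k₂ hk₂)) σ₀ hσ₀⟩)
      (σ m₂ k₂) (H m₂ k₂) (f m₂ k₂) ((Tr m₂).image (fun t ↦ res m₂ k₂ t))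
      (fun h hh ↦ hHρ m₂ k₂ h hh) (hfsec m₂ k₂) (hfS m₂ k₂ hk₂) (hSsub m₂ k₂ hk₂) (hSρ m₂ k₂ hk₂)
      (h5 m₂ k₂ hk₂) (hz m₂ k₂ hk₂) (hord m₂ k₂) (emb m₂ k₂ hk₂) (he1 m₂ k₂ hk₂) (j m₂ k₂) (hdict m₂ k₂ hk₂).1 (hAt m₂ k₂) (hPtt m₂ k₂)
      (σ m₁ k₂) (H m₁ k₂) (f m₁ k₂) ((Tr m₁).image (fun t ↦ res m₁ k₂ t))
      (fun h hh ↦ hHρ m₁ k₂ h hh) (hfsec m₁ k₂) (hfS m₁ k₂ hk₁) (hSsub m₁ k₂ hk₁) (hSρ m₁ k₂ hk₁)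
      (h5 m₁ k₂ hk₁) (hz m₁ k₂ hk₁) (emb m₁ k₂ hk₁) (he1 m₁ k₂ hk₁) (j m₁ k₂) (hdict m₁ k₂ hk₁).1 (hAt m₁ k₂) (hPtt m₁ k₂) H' t
  choose τm hτm using fun m : ℕ ↦ RingClassConj.exists_conj_algEquiv hK ι (hlev0 m)
  have hτm𝒢 : ∀ m, τm m ∉ ringClassGal ι (lev m) := fun m ↦ RingClassConj.conj_not_mem_ringClassGal (hτm m) hK
  choose Tc hTapp hT using fun m : ℕ ↦ KolyvaginConj.exists_addMonoidHom_map_smul_eq_inv_smul hK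
    (hlev0 m) W (ρ (lev m)) (fun g ↦ g.2) (AddEquiv.refl _) (fun g a ↦ hsmul (lev m) g a) (hτm𝒢 m)
  have hT' : ∀ (m) (P : (W.baseChange (ringClassField K ι (lev m))).toAffine.Point),
      Tc m P = pointGalHom W (ringClassField K ι (lev m)) (τm m) P := fun m P ↦ hTapp m P
  have hτ : IsLiftOfAut c (liftAut c) := isLiftOfAut_liftAut c
  choose rr hrr𝒢 hrres using fun m : ℕ ↦ exists_mem_ringClassGal_apply_ringHom_eq hK ι (hlev0 m) (emb m (lev m) dvd_rfl) (he1 m (lev m) dvd_rfl) hc hτ (hτm m)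
  have hjτ : ∀ (m) (a : (W.baseChange (ringClassField K ι (lev m))).toAffine.Point),
      hτ.pointsMap W (j m (lev m) a) = j m (lev m) (Tc m ((⟨rr m, hrr𝒢 m⟩ : ringClassGal ι (lev m)) • a)) := by
    intro m a
    have hg : ∀ x, liftAut c (emb m (lev m) dvd_rfl x) = emb m (lev m) dvd_rfl ((τm m * rr m) x) := fun x ↦ by
      rw [AlgEquiv.mul_apply]; exact hrres m x
    rw [pointsMap_map_ringHom_eq (emb m (lev m) dvd_rfl) (j m (lev m)) (hdict m (lev m) dvd_rfl).1 hτ hg a, hmul, hT', hsmul]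
  have hbot : ∀ (m₀ k₁ : ℕ) (hk : k₁ ∣ lev m₀), k₁ = 1 →
      j m₀ k₁ (kolyvaginPoint (σ m₀ k₁) k₁.primeFactors (f m₀ k₁) (y k₁)) = toGeomPoints (W.baseChange K) yK := by
    rintro m₀ k₁ hk rfl
    exact map_kolyvaginPoint_one_eq_toGeomPoints ι (ρ 1) (hρi 1) (AddEquiv.refl _)
      (fun g a ↦ hsmul 1 g a) (fun h hh ↦ hHρ m₀ 1 h hh) (hSsub m₀ 1 hk) (hSρ m₀ 1 hk) (h5 m₀ 1 hk)
      (f m₀ 1) (hfsec m₀ 1) (hfS m₀ 1 hk) (σ m₀ 1) (y 1) (fun T hT ↦ hB2 T hT) (emb m₀ 1 hk) (he1 m₀ 1 hk) (j m₀ 1) (hdict m₀ 1 hk).1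
  -- §§ the submodule `B(k')` with its induced `Gal(K[k']/K)`-action, and the transfer of the labels to it
  have hB𝒢 : ∀ (k') (g : ringClassGal ι k') (a : (W.baseChange (ringClassField K ι k')).toAffine.Point), a ∈ B k' → g • a ∈ B k' :=
    fun k' g a ha ↦ by rw [hsmul]; exact hBgal k' g a ha
  letI smulB : ∀ k', SMul (ringClassGal ι k') (B k') := fun k' ↦
    ⟨fun g b ↦ ⟨g • (b : (W.baseChange (ringClassField K ι k')).toAffine.Point), hB𝒢 k' g b b.2⟩⟩
  letI actB : ∀ k', DistribMulAction (ringClassGal ι k') (B k') := fun k' ↦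
    { one_smul := fun b ↦ Subtype.ext (one_smul (ringClassGal ι k') (b : (W.baseChange (ringClassField K ι k')).toAffine.Point))
      mul_smul := fun g h b ↦ Subtype.ext (mul_smul g h (b : (W.baseChange (ringClassField K ι k')).toAffine.Point))
      smul_zero := fun g ↦ Subtype.ext (smul_zero g)
      smul_add := fun g b b' ↦ Subtype.ext (smul_add g (b : (W.baseChange (ringClassField K ι k')).toAffine.Point) b') }
  have hιB : ∀ (k') (g : ringClassGal ι k') (b : B k'), (B k').subtype (g • b) = g • (B k').subtype b := fun _ _ _ ↦ rfl
  let y₀ : ∀ k', B k' := fun k' ↦ ⟨y k', hBy k'⟩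
  have htr₀ : ∀ (m k' : ℕ) (_ : k' ∣ lev m), ∀ ℓ ∈ k'.primeFactors,
      grAct (B k') (traceElt (σ m k' ℓ) ℓ) (y₀ k') ∈ zsmulRange (B k') ((p ^ M : ℕ) : ℤ) := by
    intro m k' hk ℓ hℓ; obtain ⟨y', hy'B, hrel, ha⟩ := hB4e m k' hk ℓ hℓ
    exact grAct_traceElt_mem_zsmulRange_of_map (B k').subtype (hιB k') (B k').subtype_injective (y₀ := y₀ k') (y₀' := ⟨y', hy'B⟩) hrel ha
  have hX₀ : ∀ m, ∀ b : B (lev m), ((p ^ M : ℕ) : ℤ) • b = 0 → b = 0 := fun m ↦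
    noTorsion_of_map (B (lev m)).subtype (B (lev m)).subtype_injective (hX (lev m) (hlev0 m) M)
  have hj₀ : ∀ (m) (g : absoluteGaloisGroup K) (b : B (lev m)),
      ((j m (lev m)).comp (B (lev m)).subtype) (π m (lev m) g • b) = g • ((j m (lev m)).comp (B (lev m)).subtype) b := fun m ↦
    comp_map_smul W (π m (lev m)) (j m (lev m)) (hj' m (lev m)) (B (lev m)).subtype (hιB (lev m))
  have hA₀ : ∀ m, IsAdmissible (absoluteGaloisGroup K) ((j m (lev m)).comp (B (lev m)).subtype).range ((p ^ M : ℕ) : ℤ) := fun m ↦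
    isAdmissible_range_of_galoisEquivariant (π m (lev m)) _ (hj₀ m) ((hjinj m (lev m) dvd_rfl).comp (B (lev m)).subtype_injective) (hX₀ m)
  have hPt₀ : ∀ m, ((j m (lev m)).comp (B (lev m)).subtype) (kolyvaginPoint (σ m (lev m)) (lev m).primeFactors (f m (lev m)) (y₀ (lev m))) ∈
      invPoints (absoluteGaloisGroup K) ((j m (lev m)).comp (B (lev m)).subtype).range ((p ^ M : ℕ) : ℤ) := fun m ↦
    map_kolyvaginPoint_mem_invPoints (hfsec m (lev m)) (hgen m (lev m) dvd_rfl) (hord m (lev m)) (hdvdM m (lev m) dvd_rfl) (htr₀ m (lev m) dvd_rfl) (π m (lev m)) _ (hj₀ m)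
  have hcls : ∀ m, kolyvaginClass (W.baseChange K) _ hdiv (hA₀ m) _ (hPt₀ m) = kolyvaginClass (W.baseChange K) _ hdiv (hAt m (lev m))
      (j m (lev m) (kolyvaginPoint (σ m (lev m)) (lev m).primeFactors (f m (lev m)) (y (lev m)))) (hPtt m (lev m)) := fun m ↦
    kolyvaginClass_comp_eq W (j m (lev m)) (B (lev m)).subtype (hιB (lev m)) (hA₀ m) (hAt m (lev m)) (σ m (lev m)) _ (f m (lev m)) (y₀ (lev m)) (hPt₀ m) (hPtt m (lev m))
  -- complex conjugation restricted to the submodule, its dihedral law, the geometric glue and the `τ`-eigen label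
  let T₀ : ∀ m, B (lev m) →+ B (lev m) := fun m ↦ ((Tc m).comp (B (lev m)).subtype).codRestrict (B (lev m)) fun b ↦ by
    rw [AddMonoidHom.comp_apply, hT']; exact hBgal (lev m) (τm m) _ b.2
  have hT₀ : ∀ (m) (b : B (lev m)), (B (lev m)).subtype (T₀ m b) = Tc m ((B (lev m)).subtype b) := fun _ _ ↦ rfl
  have hT₀d : ∀ (m) (γ : ringClassGal ι (lev m)) (b : B (lev m)), T₀ m (γ • b) = γ⁻¹ • T₀ m b := fun m ↦
    map_smul_eq_inv_smul_of_map (B (lev m)).subtype (hιB (lev m)) (B (lev m)).subtype_injective (T₀ m) (Tc m) (hT₀ m) (hT m)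
  have hjτ₀ : ∀ (m) (b : B (lev m)), hτ.pointsMap W (((j m (lev m)).comp (B (lev m)).subtype) b) =
      ((j m (lev m)).comp (B (lev m)).subtype) (T₀ m ((⟨rr m, hrr𝒢 m⟩ : ringClassGal ι (lev m)) • b)) := fun m ↦
    pointsMap_comp_eq_of_glue W (j m (lev m)) (B (lev m)).subtype (hιB (lev m)) (T₀ m) (Tc m) (hT₀ m) hτ (hjτ m)
  have hτy₀ : ∀ m, ∃ σ₁ : ringClassGal ι (lev m), T₀ m (y₀ (lev m)) - ε • σ₁ • y₀ (lev m) ∈ zsmulRange (B (lev m)) ((p ^ M : ℕ) : ℤ) := by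
    intro m; obtain ⟨σ₁, hσ₁, hford⟩ := hB3 (lev m) (hlev m).1 (hguard m (lev m) dvd_rfl) (τm m) (hτm m)
    refine ⟨⟨σ₁, hσ₁⟩, KolyvaginTauEigen.mem_zsmulRange_of_isOfFinAddOrder hp hM (hX₀ m)
      (((B (lev m)).subtype_injective.isOfFinAddOrder_iff (f := (B (lev m)).subtype)).mp ?_)⟩
    rw [map_sub, map_zsmul]
    change IsOfFinAddOrder (Tc m (y (lev m)) - ε • ((⟨σ₁, hσ₁⟩ : ringClassGal ι (lev m)) • y (lev m)))
    rw [hT', hsmul]; exact hford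
  choose σ₁ hσ₁ using hτy₀
  refine ⟨ε, liftAut c, hτ, fun m ↦ ((j m (lev m)).comp (B (lev m)).subtype).range, hA₀, fun m ↦ e m m,
    fun m ↦ ((j m (lev m)).comp (B (lev m)).subtype) (kolyvaginPoint (σ m (lev m)) (lev m).primeFactors (f m (lev m)) (y₀ (lev m))),
    hPt₀, hε, hB3K c hc, ?_, ?_, ?_, ?_, ?_⟩
  · exact fun m a ha ↦ pointsMap_mem_range_of_glue (T₀ m) _ hτ (hjτ₀ m) ha
  · exact (comp_kolyvaginPoint W (j 1 (lev 1)) (B (lev 1)).subtype (hιB (lev 1)) _ _ _ _).trans (hbot 1 (lev 1) dvd_rfl (hlev_eq 1 hKol1))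
  · intro m hm0 a ha Φ hΦ; obtain ⟨a₀, rfl⟩ := ha
    have hle : ringClassField K ι (lev m) ≤ ringClassField K ι m := ringClassField_mono hK ι (hlevdvd m) hm0
    letI : Algebra K ℂ := ι.toAlgebra
    obtain ⟨gq, hgq⟩ := RingClassConj.exists_algEquiv_forall_apply_eq hK ι (hlev0 m)
      ((e m m : ringClassField K ι m →+* AlgebraicClosure K).comp
        ((RingClassField.inclusion ι hle).restrictScalars ℚ : ringClassField K ι (lev m) →+* ringClassField K ι m))
      (e m (lev m) : ringClassField K ι (lev m) →+* AlgebraicClosure K)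
    have hΦ' : ∀ x : ringClassField K ι (lev m), Φ • e m (lev m) x = e m (lev m) x := fun x ↦ by
      have h1 : e m (lev m) x = e m m ((RingClassField.inclusion ι hle).restrictScalars ℚ (gq x)) := hgq x
      rw [h1]; exact hΦ _
    exact smul_map_eq_self_of_galoisDictionary (π m (lev m)) (j m (lev m)) (hj' m (lev m)) (e m (lev m)) (ρ (lev m)) (hρi (lev m))
      (hπρ' m (lev m)) (a₀ : (W.baseChange (ringClassField K ι (lev m))).toAffine.Point) Φ hΦ'
  · intro m a ha v hv; obtain ⟨b, rfl⟩ := ha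
    exact hBE0 (lev m) (emb m (lev m) dvd_rfl) (he1 m (lev m) dvd_rfl) (j m (lev m)) (hdict m (lev m) dvd_rfl).1 _ b.2 v hv
  · intro m hmsq hmkol
    have hlm : lev m = m := hlev_eq m ⟨hmsq, hmkol⟩
    refine ⟨?_, ?_, ?_⟩
    · obtain ⟨b, hb, hbeq⟩ := exists_pointsMap_map_kolyvaginPoint_eq_of_prop53 (hfsec m (lev m)) (hgen m (lev m) dvd_rfl) (hord m (lev m))
        (hdvdM m (lev m) dvd_rfl) (htr₀ m (lev m) dvd_rfl) (T₀ m) (hT₀d m) (hσ₁ m) _ hτ (hjτ₀ m)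
      have hpf : (lev m).primeFactors.card = m.primeFactors.card := by rw [hlm]
      exact ⟨b, hb, by rw [← hpf]; exact hbeq⟩
    · intro ℓ hℓp hℓm v hv a
      have hℓlm : ℓ ∣ lev m := by rw [hlm]; exact hℓm
      rw [hcls m, hcls (m / ℓ), h44t m (lev m) dvd_rfl (hlev m).1 (hKolM m (lev m) dvd_rfl) ℓ hℓp hℓlm v hv a]
      have hKol' : Kol (m / ℓ) := hKdiv m (m / ℓ) (by rw [hlm]; exact Nat.div_dvd_of_dvd hℓm)
      have hlev' : lev (m / ℓ) = lev m / ℓ := by rw [hlev_eq _ hKol', hlm]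
      exact hcmp m (lev m / ℓ) (Nat.div_dvd_of_dvd hℓlm) (m / ℓ) (lev (m / ℓ)) dvd_rfl hlev' _ _
    · obtain ⟨z, hz'⟩ := hDiv hM (lev m) (hlev m).1 (hKolM m (lev m) dvd_rfl) (fun q ↦ res m (lev m) (gen m q))
        ((Tr m).image (fun t ↦ res m (lev m) t)) (hzz m (lev m) dvd_rfl) (hSsub m (lev m) dvd_rfl) (h5 m (lev m) dvd_rfl)
      have hbij := KolyvaginH37Bridge.bijOn_of_section_of_transversal (ρ (lev m)) (hρi (lev m)) (H := H m (lev m))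
        (Γ := ringClassGal ι (lev m)) (G₁ := ringClassGalOver ι (lev m) 1) (fun h hh ↦ hHρ m (lev m) h hh)
        (S := ((Tr m).image (fun t ↦ res m (lev m) t) : Set (ringClassField K ι (lev m) ≃ₐ[ℚ] ringClassField K ι (lev m))))
        (fun s hs ↦ hSsub m (lev m) dvd_rfl s hs) (hSρ m (lev m) dvd_rfl) (fun g hg ↦ h5 m (lev m) dvd_rfl g hg)
        (f m (lev m)) (hfsec m (lev m)) (hfS m (lev m) dvd_rfl)
      have hPd := KolyvaginH37Bridge.map_kolyvaginPoint_eq_derivedPoint (pointGalHom W (ringClassField K ι (lev m))) (ρ (lev m))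
        (AddEquiv.refl (W.baseChange (ringClassField K ι (lev m))).toAffine.Point) (fun g a ↦ hsmul (lev m) g a) (hlev m).1
        (τ := fun q ↦ res m (lev m) (gen m q)) (fun q hq ↦ hσres m (lev m) dvd_rfl q hq) (f m (lev m)) hbij (y (lev m))
      exact pow_sub_zsmul_kolyvaginClass_comp_eq_zero W (j m (lev m)) (B (lev m)).subtype (hιB (lev m)) (hA₀ m) (hAt m (lev m))
        (σ m (lev m)) _ (f m (lev m)) (y₀ (lev m)) (hPt₀ m) (R := z) (hz'.trans hPd.symm)

end Summit.BirchSwinnertonDyer.BirchSwinnertonDyer.Theorems.GenusSharpKolyvagin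

end
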